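import Summits.ABC.ABC.Theses.PlacewiseSzpiro
import Summits.ABC.Harvest.OpenQuestionsGlue
import Literature.NumberTheory.DiophantineGeometry.MinimalDiscriminantFactorizationProofs
import Literature.NumberTheory.DiophantineGeometry.MinimalDiscriminantProofs
import HarnessLib

/-!
# Route PlacewiseSzpiro — crux `SingleTowerSzpiro` (stmt-ABC-22410): positioning from above

Calibration (ordering) theorems for the crux X1 = `Summit.ABC.ABC.Theses.PlacewiseSzpiro.SingleTowerSzpiro`
(«every finite tower `ord_p(Δ_min(E)) · log p` is at most `(6+ε) log N_E + C(ε)`»), filed `--supports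
stmt-ABC-22410`; they do NOT attack the crux:

* `PlacewiseSzpiroCalib.tower_le_log_minimalDiscriminantNorm` — a single tower is at most the whole
  discriminant: `ord_v(Δ_min) · log p_v ≤ log |Δ_min|` (`p_v ^ ord_v(Δ_min) ∣ |Δ_min|`,
  `WeierstrassCurve.factorization_minimalDiscriminantNorm_holds`, Silverman AEC VIII.8);
* `singleTowerSzpiro_of_szpiroConjecture` — Szpiro `6+ε` (`Literature.NumberTheory.EllipticCurves.SzpiroConjecture`,
  rung A0 currency) implies X1 with the same `ε` and `C(ε) = log max(C_Szpiro(ε), 1)` (the route header's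
  «proof of SzpiroConjecture elsewhere moots X1»);
* `singleTowerSzpiro_of_abc` — hence `ABC → SingleTowerSzpiro` (via `Summit.ABC.Harvest.szpiro_of_abc`).

Together with `Summit.ABC.ABC.Theorems.subexponentialSzpiro_of_singleTowerSzpiro` (file
`PlacewiseSzpiroPayoff.lean`) this books X1 mechanically: `ABC ⟹ Szpiro(6+ε) ⟹ SingleTowerSzpiro ⟹
SubexponentialSzpiro` («A1′ — NOT abc»). HONESTY (D-0139/D-0140): abc is not proved by any of this; the crux is
open; typed ≠ proved. No `sorry`, no new axiom, no `def`.
-/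

noncomputable section

-- `Summit.<Summit>.<Problem>` is the mandated summit-side namespace (CONVENTIONS §2); for the
-- single-conjunct summit `ABC` the two coincide, so the duplicate `ABC.ABC` is deliberate.
set_option linter.dupNamespace false

namespace Summit.ABC.ABC.Theorems

open IsDedekindDomain
open Literature.NumberTheory.EllipticCurves
open Summit.ABC.ABC.Theses.PlacewiseSzpiro

namespace PlacewiseSzpiroCalib

/-- **One tower is at most the whole discriminant**: `ord_v(Δ_min(E)) · log p_v ≤ log |Δ_min(E)|` for every
finite place `v` of `ℤ`, because `p_v ^ ord_v(Δ_min)` divides `|Δ_min| = ∏_p p ^ ord_p(Δ_min)`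
(`WeierstrassCurve.factorization_minimalDiscriminantNorm_holds`) and `|Δ_min| ≥ 1`. [folklore] -/
theorem tower_le_log_minimalDiscriminantNorm (W : WeierstrassCurve ℚ) (v : HeightOneSpectrum ℤ) :
    (W.ordMinimalDiscriminant v : ℝ) * Real.log (Rat.HeightOneSpectrum.natGenerator v : ℝ) ≤
      Real.log (W.minimalDiscriminantNorm ℤ : ℝ) := by
  have hΔ : 0 < W.minimalDiscriminantNorm ℤ := WeierstrassCurve.minimalDiscriminantNorm_pos_holds W
  have hle : Rat.HeightOneSpectrum.natGenerator v ^ W.ordMinimalDiscriminant v ≤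
      W.minimalDiscriminantNorm ℤ := by
    rw [← WeierstrassCurve.factorization_minimalDiscriminantNorm_holds W v]
    exact Nat.ordProj_le _ hΔ.ne'
  have hp : (0 : ℝ) < (Rat.HeightOneSpectrum.natGenerator v : ℝ) := by
    exact_mod_cast (Rat.HeightOneSpectrum.prime_natGenerator v).pos
  rw [← Real.log_pow]
  exact Real.log_le_log (pow_pos hp _) (by exact_mod_cast hle)

end PlacewiseSzpiroCalib

open PlacewiseSzpiroCalib

/-- **Szpiro `6+ε` ⟹ `SingleTowerSzpiro`** (positioning of the crux X1 from above). From
`|Δ_min(E)| ≤ C · N_E^{6+ε}`: every tower is `≤ log |Δ_min| ≤ log max(C,1) + (6+ε) log N_E`, so X1 holds with the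
same `ε` and the constant `log max(C, 1)`. [folklore] -/
theorem singleTowerSzpiro_of_szpiroConjecture (hS : SzpiroConjecture) : SingleTowerSzpiro := by
  intro ε hε
  obtain ⟨C, hC⟩ := hS ε hε
  refine ⟨Real.log (max C 1), fun W _ v => ?_⟩
  have hN1 : (1 : ℝ) ≤ (W.conductorNorm ℤ : ℝ) := by
    exact_mod_cast WeierstrassCurve.conductorNorm_pos_holds W
  have hN0 : (0 : ℝ) < (W.conductorNorm ℤ : ℝ) := by linarith
  have hΔ1 : (1 : ℝ) ≤ (W.minimalDiscriminantNorm ℤ : ℝ) := by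
    exact_mod_cast WeierstrassCurve.minimalDiscriminantNorm_pos_holds W
  have hΔ0 : (0 : ℝ) < (W.minimalDiscriminantNorm ℤ : ℝ) := by linarith
  have hpow : (0 : ℝ) < (W.conductorNorm ℤ : ℝ) ^ (6 + ε) := Real.rpow_pos_of_pos hN0 _
  have hmax : (0 : ℝ) < max C 1 := lt_of_lt_of_le one_pos (le_max_right C 1)
  have h1 : (W.minimalDiscriminantNorm ℤ : ℝ) ≤ max C 1 * (W.conductorNorm ℤ : ℝ) ^ (6 + ε) :=
    (hC W).trans (mul_le_mul_of_nonneg_right (le_max_left C 1) hpow.le)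
  calc (W.ordMinimalDiscriminant v : ℝ) * Real.log (Rat.HeightOneSpectrum.natGenerator v : ℝ)
      ≤ Real.log (W.minimalDiscriminantNorm ℤ : ℝ) := tower_le_log_minimalDiscriminantNorm W v
    _ ≤ Real.log (max C 1 * (W.conductorNorm ℤ : ℝ) ^ (6 + ε)) := Real.log_le_log hΔ0 h1
    _ = (6 + ε) * Real.log (W.conductorNorm ℤ : ℝ) + Real.log (max C 1) := by
        rw [Real.log_mul hmax.ne' hpow.ne', Real.log_rpow hN0]
        ring

/-- **`ABC ⟹ SingleTowerSzpiro`**: the summit implies the crux X1 (abc ⟹ Szpiro `6+ε`,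
`Summit.ABC.Harvest.szpiro_of_abc` — Silverman AEC VIII.11.5(b) / Bombieri–Gubler 12.5.12 — then
`singleTowerSzpiro_of_szpiroConjecture`). [folklore] -/
theorem singleTowerSzpiro_of_abc (hA : _root_.ABC) : SingleTowerSzpiro :=
  singleTowerSzpiro_of_szpiroConjecture (Summit.ABC.Harvest.szpiro_of_abc hA)

end Summit.ABC.ABC.Theorems

end
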